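import Literature.Probability.Percolation.TriCrossingsMeet
import Literature.Probability.Percolation.PercolationEvents
import Literature.Probability.Percolation.Crossings
import Literature.Probability.LatticeModels.TriangularLattice
import HarnessLib

/-!
# Five-arm sites with a landing sequence occur at most once (Nolin's uniqueness; KSZ's `F(w,n)`)

Topic `Literature/Probability/Percolation`; family `crit-perc`. PROOFS ONLY (no named fact). The
deterministic heart of the UPPER bound `α₅ ≤ 2` for the universal five-arm exponent (P. Nolin,
*Near-critical percolation in two dimensions*, EJP 13 (2008), §5.2, proof of Thm. 24, five-arm item
[arXiv 0711.4948: Thm. 23 (iii), pp. 16–17]; H. Kesten, V. Sidoravicius, Y. Zhang, *Almost all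
words are seen in critical site percolation on the triangular lattice*, EJP 3 (1998), proof of
Lemma 5, (3.10)–(3.11)):

> "Take the particular landing sequence `I₁, …, I₅` depicted on the figure, and consider the event
> `A_v := {v ⇝^I_{5,σ} ∂S_N} ∩ {v is black}` [`σ = BWBBW`] … We claim that `A_v` can occur for at
> most one site `v`. Indeed, assume that `A_v` and `A_w` occur … Since `r₁ ∪ r₄ ∪ {v}` separates
> `I₃` from `I₅`, necessarily `w ∈ r₁ ∪ r₄ ∪ {v}` … only one arm can 'go through' `r₃ ∪ r₅`: the arm
> `r'₁ ∪ {w}` from `w` to `I₁` has to contain `v`, and so does `r'₂ ∪ {w}` … we get finally `v = w`.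
> Consequently, `1 ≥ P_{1/2}(∪_{v ∈ S_{N/2}} A_v) = Σ_{v ∈ S_{N/2}} P_{1/2}(A_v)`."

KSZ (proof of Lemma 5): "`F(w, n)` [three occupied paths to the left and right edges of `S(n)`,
two vacant ones to the upper and lower edge] can occur for at most one `w ∈ S(n)` and consequently
`Σ_{w ∈ S(n/2)} P{w is occupied and F(w, n)} ≤ 1`."

## Contents

* `IsLandingArm ω D I v c S` — an arm of colour `c` at `v` landing in `I`: a `c`-monochromatic set
  of sites `S ⊆ D ∖ {v}` containing a neighbour of `v`, every site of which is joined inside `S`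
  to one landing site `b ∈ I`.
* `fiveArmLanding D I v` — Nolin's `A_v`: `v ∈ D` is black and carries five pairwise disjoint
  landing arms of colours `B, W, B, B, W` to `I 0, …, I 4` (in Nolin's numbering `I₁, …, I₅`).
* `LandingMeet D I J K L` — the separation input: inside `D`, every path from `I` to `J` meets
  every path from `K` to `L`.
* `fiveArmLanding_unique` — **uniqueness**: if paths from `I 0` to `I 2` and from `I 0` to `I 3`
  meet paths from `I 1` to `I 4`, then `A_v ∩ A_w = ∅` for `v ≠ w`. The proof is Nolin's, run with
  the two interlacing pairs `{I₁, I₃} | {I₂, I₅}`, `{I₁, I₄} | {I₂, I₅}`: (1) the black path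
  `r₁ v r₃` (resp. `r₁ v r₄`) meets the white path `r'₂ w r'₅` only at `w`, so
  `w ∈ r₁ ∪ {v} ∪ (r₃ ∩ r₄) = r₁ ∪ {v}`; (2) if `w ∈ r₁`, the black paths `I₁ ← r₁ ∋ w → r'₃ → I₃`
  and `… → r'₄ → I₄` meet the white path `r₅ v r₂` only at `v`, so `v ∈ r'₃ ∩ r'₄ = ∅`. Only
  `r₃ ∩ r₄ = ∅`, `r'₃ ∩ r'₄ = ∅` and the colours are used.
* `sum_real_fiveArmLanding_le_one` — `Σ_{v ∈ V} μ(A_v) ≤ 1` for every probability measure `μ`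
  and every finite set `V` of sites when `D` is finite (the `A_v` are measurable and pairwise
  disjoint) — Nolin's display, KSZ's (3.11); valid at every density (no symmetry is used).
* The parallelogram `R(M, N) = [0, M] × [0, N]` of `𝕋` (`rectangle M N`): `landingMeet_rectangle`
  (from `PathIn.tri_crossings_meet`, Kesten 1982, §2.2), `rectSides M N` (left, top, right, right,
  bottom — the mirror image of KSZ's `F(w, n)`), `fiveArmLanding_rectangle_unique` and
  `sum_real_fiveArmLanding_rectangle_le_one`.

What is NOT here (and is the input of the printed upper bound `N² P_{1/2}(0 ⇝⁵ ∂S_N) ≤ C`):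
the comparison `P(A_v) ≍ P(0 ⇝^{5,σ} ∂S_N)` uniformly in `v ∈ S_{N/2}` (Nolin: arm separation,
Thm. 11 and Prop. 12; KSZ: (3.12) and the Appendix to Lemma 5).

## References

* P. Nolin, Near-critical percolation in two dimensions, *Electron. J. Probab.* 13 (2008)
  1562–1623, §5.2, proof of Thm. 24 (arXiv 0711.4948: Thm. 23 (iii), pp. 16–17) [Nolin2008].
* H. Kesten, V. Sidoravicius, Y. Zhang, Almost all words are seen in critical site percolation on
  the triangular lattice, *Electron. J. Probab.* 3 (1998), paper 10, proof of Lemma 5,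
  (3.10)–(3.11) [KestenSidoraviciusZhang1998].
* H. Kesten, *Percolation theory for mathematicians*, Birkhäuser (1982), §2.2 (paths crossing a
  rectangle meet) [KestenPTM1982].

## Mathlib / tree

Tree: `PathIn` (`SitePaths.lean`), `PathIn.tri_crossings_meet` (`TriCrossingsMeet.lean`),
`rectangle`, `mem_rectangle_iff` (`Crossings.lean`), `DeterminedBy`, `determinedBy_iff`,
`DeterminedBy.measurableSet_of_finset` (`PercolationEvents.lean`). Mathlib:
`MeasureTheory.measureReal_biUnion_finset`, `MeasureTheory.prob_le_one`.
-/

noncomputable section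

open Set MeasureTheory

namespace Literature.Probability.Percolation

open LatticeModels

/-! ### Landing arms and Nolin's event `A_v` -/

/-- **A landing arm.** In the configuration `ω`, `S` is an arm of colour `c` at the site `v`
landing in `I`, inside the region `D`: `S ⊆ D`, `v ∉ S`, every site of `S` has colour `c`
(`true` = black/open/occupied, `false` = white/closed/vacant), `S` contains a neighbour `a` of `v`
and a landing site `b ∈ I` to which every site of `S` is joined by a `𝕋`-path inside `S`
(Nolin 2008, §4.2 and §5.2: an arm `r_i` from `∂v` to the landing area `I_i`; KSZ 1998, (3.10):
"paths from neighbors of `w`" with "endpoint on the left edge"). [cite: Nolin2008, §5.2, proof of Thm. 24 (arXiv 0711.4948: p. 16, the event A_v)] -/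
def IsLandingArm (ω : SiteConfig (Site 2)) (D I : Set (Site 2)) (v : Site 2) (c : Bool)
    (S : Set (Site 2)) : Prop :=
  S ⊆ D ∧ v ∉ S ∧ (∀ z ∈ S, (z ∈ ω ↔ c)) ∧
    ∃ a b : Site 2, a ∈ S ∧ triGraph.Adj v a ∧ b ∈ I ∧ ∀ z ∈ S, PathIn triGraph S z b

/-- Nolin's colour sequence `σ = BWBBW` attached to the landing areas `I₁, …, I₅` (here
`I 0, …, I 4`). [cite: Nolin2008, §5.2, proof of Thm. 24 (arXiv 0711.4948: p. 16, "σ = BWBBW")] -/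
def nolinFive : Fin 5 → Bool := ![true, false, true, true, false]

/-- `σ₁ = B`. [cite: Nolin2008, §5.2, proof of Thm. 24 (arXiv 0711.4948: p. 16, "σ = BWBBW")] -/
@[simp] theorem nolinFive_zero : nolinFive 0 = true := rfl

/-- `σ₂ = W`. [cite: Nolin2008, §5.2, proof of Thm. 24 (arXiv 0711.4948: p. 16, "σ = BWBBW")] -/
@[simp] theorem nolinFive_one : nolinFive 1 = false := rfl

/-- `σ₃ = B`. [cite: Nolin2008, §5.2, proof of Thm. 24 (arXiv 0711.4948: p. 16, "σ = BWBBW")] -/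
@[simp] theorem nolinFive_two : nolinFive 2 = true := rfl

/-- `σ₄ = B`. [cite: Nolin2008, §5.2, proof of Thm. 24 (arXiv 0711.4948: p. 16, "σ = BWBBW")] -/
@[simp] theorem nolinFive_three : nolinFive 3 = true := rfl

/-- `σ₅ = W`. [cite: Nolin2008, §5.2, proof of Thm. 24 (arXiv 0711.4948: p. 16, "σ = BWBBW")] -/
@[simp] theorem nolinFive_four : nolinFive 4 = false := rfl

/-- **Nolin's event `A_v`** (EJP 2008, proof of Thm. 24: "`A_v := {v ⇝^I_{5,σ} ∂S_N} ∩ {v is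
black}`", `σ = BWBBW`; KSZ 1998, (3.10), `{w occupied} ∩ F(w, n)` up to a reflection): the site
`v ∈ D` is black and there are five pairwise disjoint landing arms at `v` inside `D`, of colours
black, white, black, black, white, landing in `I 0, I 1, I 2, I 3, I 4` respectively. [cite: Nolin2008, §5.2, proof of Thm. 24 (arXiv 0711.4948: p. 16, the event A_v)] [cite: KestenSidoraviciusZhang1998, proof of Lemma 5, (3.10)] -/
def fiveArmLanding (D : Set (Site 2)) (I : Fin 5 → Set (Site 2)) (v : Site 2) :
    Set (SiteConfig (Site 2)) :=
  {ω | v ∈ D ∧ v ∈ ω ∧ ∃ S : Fin 5 → Set (Site 2),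
    (∀ i, IsLandingArm ω D (I i) v (nolinFive i) (S i)) ∧ Pairwise fun i j => Disjoint (S i) (S j)}

/-- **The separation input**: inside `D`, every `𝕋`-path from `I` to `J` meets every `𝕋`-path
from `K` to `L` (for a parallelogram and its sides this is Kesten 1982, §2.2; Nolin: "`r₁ ∪ r₄ ∪ {v}`
separates `I₃` from `I₅`"). [cite: KestenPTM1982, §2.2 (paths crossing a rectangle must intersect)] -/
def LandingMeet (D I J K L : Set (Site 2)) : Prop :=
  ∀ ⦃A A' : Set (Site 2)⦄ ⦃a b c d : Site 2⦄, A ⊆ D → A' ⊆ D → a ∈ I → b ∈ J → c ∈ K → d ∈ L →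
    PathIn triGraph A a b → PathIn triGraph A' c d → ∃ z, z ∈ A ∧ z ∈ A'

/-! ### Paths through the centre and through a site of an arm -/

namespace IsLandingArm

variable {ω : SiteConfig (Site 2)} {D I J : Set (Site 2)} {v : Site 2} {c c' : Bool}
  {S T : Set (Site 2)}

/-- The arm lies in the region. [cite: Nolin2008, §5.2, proof of Thm. 24 (arXiv 0711.4948: p. 16)] -/
theorem subset (h : IsLandingArm ω D I v c S) : S ⊆ D := h.1

/-- The centre is not on the arm. [cite: Nolin2008, §5.2, proof of Thm. 24 (arXiv 0711.4948: p. 16)] -/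
theorem not_mem (h : IsLandingArm ω D I v c S) : v ∉ S := h.2.1

/-- The colour of a site of the arm. [cite: Nolin2008, §5.2, proof of Thm. 24 (arXiv 0711.4948: p. 16)] -/
theorem mem_iff (h : IsLandingArm ω D I v c S) {z : Site 2} (hz : z ∈ S) : z ∈ ω ↔ c := h.2.2.1 z hz

/-- **The two-arm path through the centre.** Two landing arms `S` (to `I`) and `T` (to `J`) at
`v` give a path from `I` to `J` inside `S ∪ {v} ∪ T` (Nolin: "`r₁ ∪ r₄ ∪ {v}`"). [cite: Nolin2008, §5.2, proof of Thm. 24 (arXiv 0711.4948: p. 17)] -/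
theorem exists_pathIn_through (hS : IsLandingArm ω D I v c S) (hT : IsLandingArm ω D J v c' T) :
    ∃ b d : Site 2, b ∈ I ∧ d ∈ J ∧ PathIn triGraph (S ∪ {v} ∪ T) b d := by
  obtain ⟨a, b, ha, hva, hb, hconn⟩ := hS.2.2.2
  obtain ⟨a', d, ha', hva', hd, hconn'⟩ := hT.2.2.2
  refine ⟨b, d, hb, hd, ?_⟩
  have h1 : PathIn triGraph (S ∪ {v} ∪ T) b a :=
    ((hconn a ha).symm).mono (subset_union_left.trans subset_union_left)
  have h2 : PathIn triGraph (S ∪ {v} ∪ T) b v :=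
    h1.tail hva.symm (subset_union_left (subset_union_right rfl))
  have h3 : PathIn triGraph (S ∪ {v} ∪ T) b a' := h2.tail hva' (subset_union_right ha')
  exact h3.trans ((hconn' a' ha').mono subset_union_right)

/-- **The path through a site of an arm.** If `w` lies on the landing arm `S` (to `I`) at `v`, and
`T` (to `J`) is a landing arm at `w`, there is a path from `I` to `J` inside `S ∪ T` (Nolin: "the
arm `r'₁ ∪ {w}` from `w` to `I₁`"). [cite: Nolin2008, §5.2, proof of Thm. 24 (arXiv 0711.4948: p. 17)] -/
theorem exists_pathIn_via {w : Site 2} (hS : IsLandingArm ω D I v c S) (hw : w ∈ S)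
    (hT : IsLandingArm ω D J w c' T) :
    ∃ b d : Site 2, b ∈ I ∧ d ∈ J ∧ PathIn triGraph (S ∪ T) b d := by
  obtain ⟨-, b, -, -, hb, hconn⟩ := hS.2.2.2
  obtain ⟨a', d, ha', hwa', hd, hconn'⟩ := hT.2.2.2
  refine ⟨b, d, hb, hd, ?_⟩
  have h1 : PathIn triGraph (S ∪ T) b w := ((hconn w hw).symm).mono subset_union_left
  have h2 : PathIn triGraph (S ∪ T) b a' := h1.tail hwa' (subset_union_right ha')
  exact h2.trans ((hconn' a' ha').mono subset_union_right)

end IsLandingArm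

/-! ### Uniqueness -/

section Unique

variable {D : Set (Site 2)} {I : Fin 5 → Set (Site 2)} {ω : SiteConfig (Site 2)} {v w : Site 2}

/-- **Step 1 of Nolin's argument.** If `A_v` and `A_w` occur with arms `S`, `S'`, and paths from
`I 0` to `I j` meet paths from `I 1` to `I 4` (`j = 2` or `3`, a black landing area), then
`w ∈ S 0 ∪ {v} ∪ S j`: the black path `r₁ v r_j` meets the white path `r'₂ w r'₅` at a site which
can only be `w`. [cite: Nolin2008, §5.2, proof of Thm. 24 (arXiv 0711.4948: p. 17, "necessarily w ∈ r₁ ∪ r₄ ∪ {v}")] -/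
theorem mem_arms_of_landingMeet {j : Fin 5} (hj : nolinFive j = true)
    (hmeet : LandingMeet D (I 0) (I j) (I 1) (I 4)) (hvD : v ∈ D) (hv : v ∈ ω)
    {S S' : Fin 5 → Set (Site 2)} (hS : ∀ i, IsLandingArm ω D (I i) v (nolinFive i) (S i))
    (hwD : w ∈ D) (hS' : ∀ i, IsLandingArm ω D (I i) w (nolinFive i) (S' i)) :
    w ∈ S 0 ∪ {v} ∪ S j := by
  obtain ⟨b, d, hb, hd, hP⟩ := (hS 0).exists_pathIn_through (hS j)
  obtain ⟨b', d', hb', hd', hQ⟩ := (hS' 1).exists_pathIn_through (hS' 4)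
  have hA : S 0 ∪ {v} ∪ S j ⊆ D :=
    union_subset (union_subset (hS 0).subset (singleton_subset_iff.2 hvD)) (hS j).subset
  have hA' : S' 1 ∪ {w} ∪ S' 4 ⊆ D :=
    union_subset (union_subset (hS' 1).subset (singleton_subset_iff.2 hwD)) (hS' 4).subset
  obtain ⟨z, hzA, hzA'⟩ := hmeet hA hA' hb hd hb' hd' hP hQ
  -- `z` is black
  have hzω : z ∈ ω := by
    rcases hzA with (hz | hz) | hz
    · exact ((hS 0).mem_iff hz).2 rfl
    · rw [mem_singleton_iff.1 hz]; exact hv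
    · exact ((hS j).mem_iff hz).2 hj
  -- so it is neither on `r'₂` nor on `r'₅`
  rcases hzA' with (hz | hz) | hz
  · exact absurd (((hS' 1).mem_iff hz).1 hzω) (by simp)
  · rw [mem_singleton_iff.1 hz] at hzA; exact hzA
  · exact absurd (((hS' 4).mem_iff hz).1 hzω) (by simp)

/-- **Step 2 of Nolin's argument.** If moreover `w` lies on the arm `r₁ = S 0` of `v`, then `v`
lies on the black arm `r'_j` of `w` (`j = 2` or `3`): the black path `I 0 ← r₁ ∋ w → r'_j → I j`
meets the white path `r₅ v r₂` at a site which can only be `v`. [cite: Nolin2008, §5.2, proof of Thm. 24 (arXiv 0711.4948: p. 17, "only one arm can go through r₃ ∪ r₅")] -/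
theorem mem_arm_of_mem_arm {j : Fin 5} (hj : nolinFive j = true)
    (hmeet : LandingMeet D (I 0) (I j) (I 1) (I 4)) (hvD : v ∈ D)
    {S S' : Fin 5 → Set (Site 2)} (hS : ∀ i, IsLandingArm ω D (I i) v (nolinFive i) (S i))
    (hS' : ∀ i, IsLandingArm ω D (I i) w (nolinFive i) (S' i)) (hw : w ∈ S 0) :
    v ∈ S' j := by
  obtain ⟨b, d, hb, hd, hP⟩ := (hS 0).exists_pathIn_via hw (hS' j)
  obtain ⟨b', d', hb', hd', hQ⟩ := (hS 1).exists_pathIn_through (hS 4)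
  have hA : S 0 ∪ S' j ⊆ D := union_subset (hS 0).subset (hS' j).subset
  have hA' : S 1 ∪ {v} ∪ S 4 ⊆ D :=
    union_subset (union_subset (hS 1).subset (singleton_subset_iff.2 hvD)) (hS 4).subset
  obtain ⟨z, hzA, hzA'⟩ := hmeet hA hA' hb hd hb' hd' hP hQ
  -- `z` is black
  have hzω : z ∈ ω := by
    rcases hzA with hz | hz
    · exact ((hS 0).mem_iff hz).2 rfl
    · exact ((hS' j).mem_iff hz).2 hj
  -- so it is `v`, which is not on `r₁`
  have hzv : z = v := by
    rcases hzA' with (hz | hz) | hz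
    · exact absurd (((hS 1).mem_iff hz).1 hzω) (by simp)
    · exact mem_singleton_iff.1 hz
    · exact absurd (((hS 4).mem_iff hz).1 hzω) (by simp)
  subst hzv
  rcases hzA with hz | hz
  · exact absurd hz (hS 0).not_mem
  · exact hz

/-- **Nolin's uniqueness lemma: `A_v` occurs for at most one site `v`.** Let `D` be a region and
`I 0, …, I 4` landing areas such that, inside `D`, paths from `I 0` to `I 2` and paths from `I 0`
to `I 3` meet every path from `I 1` to `I 4` (true when `I 0, …, I 4` lie in this cyclic order on
the boundary of a simply connected `D`; for a parallelogram, `landingMeet_rectangle`). If a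
configuration lies in `A_v` and in `A_w` (black centre, arms `B, W, B, B, W` landing in
`I 0, …, I 4`), then `v = w`. Proof: by Step 1 for `j = 2, 3`, `w ∈ r₁ ∪ {v} ∪ (r₃ ∩ r₄) = r₁ ∪ {v}`;
if `w ∈ r₁`, Step 2 for `j = 2, 3` puts `v` on the two disjoint arms `r'₃`, `r'₄` of `w`. (KSZ
1998 prove the mirror-image statement for `F(w, n)` through the lowest crossing.) [cite: Nolin2008, §5.2, proof of Thm. 24 (arXiv 0711.4948: p. 17, "A_v can occur for at most one site v")] [cite: KestenSidoraviciusZhang1998, proof of Lemma 5 ("F(w,n) can occur for at most one w")] -/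
theorem fiveArmLanding_unique (hmeet₂ : LandingMeet D (I 0) (I 2) (I 1) (I 4))
    (hmeet₃ : LandingMeet D (I 0) (I 3) (I 1) (I 4))
    (hv : ω ∈ fiveArmLanding D I v) (hw : ω ∈ fiveArmLanding D I w) : v = w := by
  obtain ⟨hvD, hvω, S, hS, hdisj⟩ := hv
  obtain ⟨hwD, -, S', hS', hdisj'⟩ := hw
  have h2 := mem_arms_of_landingMeet rfl hmeet₂ hvD hvω hS hwD hS'
  have h3 := mem_arms_of_landingMeet rfl hmeet₃ hvD hvω hS hwD hS'
  -- `w ∈ r₁ ∪ {v}`, since `r₃ ∩ r₄ = ∅`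
  have hw01 : w ∈ S 0 ∨ w = v := by
    rcases h2 with (hz | hz) | hz2
    · exact Or.inl hz
    · exact Or.inr (mem_singleton_iff.1 hz)
    rcases h3 with (hz | hz) | hz3
    · exact Or.inl hz
    · exact Or.inr (mem_singleton_iff.1 hz)
    exact absurd hz3 (disjoint_left.1 (hdisj (by decide : (2 : Fin 5) ≠ 3)) hz2)
  rcases hw01 with hw0 | rfl
  · -- `w ∈ r₁`: then `v ∈ r'₃ ∩ r'₄ = ∅`
    have hv2 := mem_arm_of_mem_arm rfl hmeet₂ hvD hS hS' hw0
    have hv3 := mem_arm_of_mem_arm rfl hmeet₃ hvD hS hS' hw0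
    exact absurd hv3 (disjoint_left.1 (hdisj' (by decide : (2 : Fin 5) ≠ 3)) hv2)
  · rfl

/-- The events `A_v`, `v` ranging over all sites, are pairwise disjoint. [cite: Nolin2008, §5.2, proof of Thm. 24 (arXiv 0711.4948: p. 17)] -/
theorem pairwise_disjoint_fiveArmLanding (hmeet₂ : LandingMeet D (I 0) (I 2) (I 1) (I 4))
    (hmeet₃ : LandingMeet D (I 0) (I 3) (I 1) (I 4)) :
    Pairwise fun v w : Site 2 => Disjoint (fiveArmLanding D I v) (fiveArmLanding D I w) :=
  fun _ _ hvw => disjoint_left.2 fun _ hv hw => hvw (fiveArmLanding_unique hmeet₂ hmeet₃ hv hw)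

end Unique

/-! ### Measurability and the sum over the centres -/

/-- `A_v` only looks at the sites of `D`. [cite: Nolin2008, §5.2, proof of Thm. 24 (arXiv 0711.4948: p. 16)] -/
theorem determinedBy_fiveArmLanding (D : Set (Site 2)) (I : Fin 5 → Set (Site 2)) (v : Site 2) :
    DeterminedBy (fiveArmLanding D I v) D := by
  rw [determinedBy_iff]
  suffices key : ∀ ω ω' : Set (Site 2), ω ∩ D = ω' ∩ D →
      ω ∈ fiveArmLanding D I v → ω' ∈ fiveArmLanding D I v from
    fun ω ω' h => ⟨key ω ω' h, key ω' ω h.symm⟩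
  intro ω ω' h ⟨hvD, hvω, S, hS, hdisj⟩
  have agree : ∀ z ∈ D, z ∈ ω ↔ z ∈ ω' := fun z hz => by
    constructor
    · intro hzω; exact ((Set.ext_iff.1 h z).1 ⟨hzω, hz⟩).1
    · intro hzω; exact ((Set.ext_iff.1 h z).2 ⟨hzω, hz⟩).1
  refine ⟨hvD, (agree v hvD).1 hvω, S, fun i => ?_, hdisj⟩
  obtain ⟨hsub, hnot, hcol, hrest⟩ := hS i
  exact ⟨hsub, hnot, fun z hz => (agree z (hsub hz)).symm.trans (hcol z hz), hrest⟩

/-- For a finite region `D`, `A_v` is measurable. [cite: Nolin2008, §5.2, proof of Thm. 24 (arXiv 0711.4948: p. 16)] -/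
theorem measurableSet_fiveArmLanding (D : Finset (Site 2)) (I : Fin 5 → Set (Site 2)) (v : Site 2) :
    MeasurableSet (fiveArmLanding ↑D I v) :=
  (determinedBy_fiveArmLanding ↑D I v).measurableSet_of_finset

/-- **`Σ_v P(A_v) ≤ 1`** (Nolin 2008, proof of Thm. 24: "`1 ≥ P_{1/2}(∪_{v ∈ S_{N/2}} A_v) =
Σ_{v ∈ S_{N/2}} P_{1/2}(A_v)`"; KSZ 1998, (3.11)). For a finite region `D` with landing areas as in
`fiveArmLanding_unique`, every probability measure `μ` on the site configurations and every finite
set `V` of centres: `Σ_{v ∈ V} μ(A_v) ≤ 1` — the events are measurable and pairwise disjoint. No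
symmetry of `μ` is used, so this holds at every density `p` (cf. Nolin's Lemma 25
[arXiv Lemma 24]). [cite: Nolin2008, §5.2, proof of Thm. 24 (arXiv 0711.4948: p. 17, first display)] [cite: KestenSidoraviciusZhang1998, proof of Lemma 5, (3.11)] -/
theorem sum_real_fiveArmLanding_le_one (μ : Measure (SiteConfig (Site 2))) [IsProbabilityMeasure μ]
    (D : Finset (Site 2)) {I : Fin 5 → Set (Site 2)}
    (hmeet₂ : LandingMeet ↑D (I 0) (I 2) (I 1) (I 4)) (hmeet₃ : LandingMeet ↑D (I 0) (I 3) (I 1) (I 4))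
    (V : Finset (Site 2)) :
    ∑ v ∈ V, μ.real (fiveArmLanding ↑D I v) ≤ 1 := by
  rw [← measureReal_biUnion_finset
    (fun v _ w _ hvw => pairwise_disjoint_fiveArmLanding hmeet₂ hmeet₃ hvw)
    (fun v _ => measurableSet_fiveArmLanding D I v)]
  exact measureReal_le_one

/-! ### The parallelogram `R(M, N)` -/

/-- **Crossing paths of a parallelogram meet, in `LandingMeet` form**: inside
`R(M, N) = [0, M] × [0, N]`, every path from the left side `{x₀ = 0}` to the right side `{x₀ = M}`
meets every path from the top side `{x₁ = N}` to the bottom side `{x₁ = 0}`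
(`PathIn.tri_crossings_meet`). The sets `J ⊆ {x₀ = M}`, `K ⊆ {x₁ = N}`, `L ⊆ {x₁ = 0}`,
`I ⊆ {x₀ = 0}` are arbitrary parts of the sides. [cite: KestenPTM1982, §2.2 (paths crossing a rectangle must intersect)] -/
theorem landingMeet_rectangle (M N : ℕ) {I J K L : Set (Site 2)} (hI : ∀ z ∈ I, z 0 = 0)
    (hJ : ∀ z ∈ J, z 0 = M) (hK : ∀ z ∈ K, z 1 = N) (hL : ∀ z ∈ L, z 1 = 0) :
    LandingMeet (↑(rectangle M N)) I J K L := by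
  intro A A' a b c d hA hA' ha hb hc hd hP hQ
  have hAco : ∀ z ∈ A, (0 : ℤ) ≤ z 0 ∧ z 0 ≤ M ∧ (0 : ℤ) ≤ z 1 ∧ z 1 ≤ N := fun z hz => by
    simpa [Finset.mem_coe, mem_rectangle_iff] using hA hz
  have hA'co : ∀ z ∈ A', (0 : ℤ) ≤ z 0 ∧ z 0 ≤ M ∧ (0 : ℤ) ≤ z 1 ∧ z 1 ≤ N := fun z hz => by
    simpa [Finset.mem_coe, mem_rectangle_iff] using hA' hz
  exact PathIn.tri_crossings_meet hAco hA'co hP (hI a ha) (hJ b hb) hQ.symm (hL d hd) (hK c hc)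

/-- **The landing sides of the parallelogram** (the mirror image of KSZ's `F(w, n)`: "three
occupied paths with their endpoint on the left edge (respectively, right edge) … the vacant paths
with endpoints on the upper and lower edge"): black to the left side, white to the top side, black,
black to the right side, white to the bottom side of `R(M, N)`. [cite: KestenSidoraviciusZhang1998, proof of Lemma 5, (3.10) and Figure 2] -/
def rectSides (M N : ℕ) : Fin 5 → Set (Site 2) :=
  ![{z | z 0 = 0}, {z | z 1 = N}, {z | z 0 = M}, {z | z 0 = M}, {z | z 1 = 0}]

/-- **Uniqueness in a parallelogram** (KSZ 1998: "`F(w, n)` can occur for at most one `w ∈ S(n)`";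
Nolin 2008: "`A_v` can occur for at most one site `v`"): two sites of `R(M, N)` that are black and
carry five pairwise disjoint arms inside `R(M, N)` — black to the left side, white to the top,
two black to the right side, white to the bottom — coincide. [cite: KestenSidoraviciusZhang1998, proof of Lemma 5 ("This uniquely locates w in S(n)")] [cite: Nolin2008, §5.2, proof of Thm. 24 (arXiv 0711.4948: p. 17)] -/
theorem fiveArmLanding_rectangle_unique {M N : ℕ} {ω : SiteConfig (Site 2)} {v w : Site 2}
    (hv : ω ∈ fiveArmLanding ↑(rectangle M N) (rectSides M N) v)
    (hw : ω ∈ fiveArmLanding ↑(rectangle M N) (rectSides M N) w) : v = w :=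
  fiveArmLanding_unique
    (landingMeet_rectangle M N (fun _ h => h) (fun _ h => h) (fun _ h => h) (fun _ h => h))
    (landingMeet_rectangle M N (fun _ h => h) (fun _ h => h) (fun _ h => h) (fun _ h => h)) hv hw

/-- **`Σ_{v} P(A_v) ≤ 1` in a parallelogram, at every density** (KSZ 1998, (3.11):
"`Σ_{w ∈ S(n/2)} P{w is occupied and F(w, n)} ≤ 1`"; Nolin 2008, proof of Thm. 24, first display
of p. 17): for every probability measure `μ` on the site configurations of `𝕋` (in particular
every `P_p = triSitePercolation p`) and every finite set `V` of sites,
`Σ_{v ∈ V} μ(A_v) ≤ 1` for the landing events of `R(M, N)`. [cite: KestenSidoraviciusZhang1998, proof of Lemma 5, (3.11)] [cite: Nolin2008, §5.2, proof of Thm. 24 (arXiv 0711.4948: p. 17, first display)] -/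
theorem sum_real_fiveArmLanding_rectangle_le_one (μ : Measure (SiteConfig (Site 2)))
    [IsProbabilityMeasure μ] (M N : ℕ) (V : Finset (Site 2)) :
    ∑ v ∈ V, μ.real (fiveArmLanding ↑(rectangle M N) (rectSides M N) v) ≤ 1 :=
  sum_real_fiveArmLanding_le_one μ (rectangle M N)
    (landingMeet_rectangle M N (fun _ h => h) (fun _ h => h) (fun _ h => h) (fun _ h => h))
    (landingMeet_rectangle M N (fun _ h => h) (fun _ h => h) (fun _ h => h) (fun _ h => h)) V

end Literature.Probability.Percolation
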